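import Summits.AtomisticToContinuum.HydrodynamicLimit.Theses.CollisionIsometryCLT
import Literature.Analysis.FluidPDE.HardSphereCollisionRecord

/-!
# Sketch — first lemmas of two crux ideas for `AprioriBounds` (stmt-AtomisticToContinuum-9519)

Ideator 2, round 1. Each `def … : Prop` below is the FIRST CHECKABLE STATEMENT of one line; none is
proved here (crux-ideate files no skeleton). They elaborate over existing declarations only.
-/

set_option autoImplicit false

namespace Summit.AtomisticToContinuum.HydrodynamicLimit.Cruxes.AprioriBounds.IdeatorTwo

open scoped BigOperators ENNReal
open MeasureTheory Filter Set Topology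
open Literature.Analysis.FluidPDE Literature.MathematicalPhysics.KineticTheory

/-- Card 1 (`stiff-localised-povzner`), first lemma — **velocity telescoping along the flow**:
for a good initial datum, every velocity observable `ψ` changes over `(0, t]` exactly by the sum
over collision records of the jump of the FIRST particle of the ordered pair (each collision is
recorded as both ordered pairs, so both partners are counted). Pure trajectory bookkeeping
(piecewise free flight, jumps at the locally finite collision times); the `p`-th moment / Gaussian
functionals of the line are the instances `ψ = ‖·‖^{2p}`, `ψ = exp(a‖·‖²) ∧ L`. -/
def VelocityTelescoping : Prop :=
  ∀ (σ : ℝ) (N : ℕ)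
    (Φ : HardSphereFlow (Torus.geometry (Fin 3)) (hsDiameter σ N) (N + 1))
    (ψ : V3 → ℝ), Continuous ψ → ∀ z ∈ Φ.good, ∀ t₁ t₂ : ℝ, 0 ≤ t₁ → t₁ ≤ t₂ →
      t₁ ∉ collisionTimes (Torus.geometry (Fin 3)) (hsDiameter σ N) (fun s => Φ.flow s z) →
      (∑ i, ψ ((Φ.flow t₂ z i).2)) - (∑ i, ψ ((Φ.flow t₁ z i).2)) =
        Φ.collisionSum (Ioc t₁ t₂)
          (fun c : HardSphereCollisionRecord (Fin 3) T3 (N + 1) => ψ c.postVel.1 - ψ c.preVel.1) z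

/-- Card 1, the shape of the localised DISSIPATION BUDGET it feeds (stated, not the crux): on the
event that the initial empirical Gaussian content is at most `C₀`, the total collisional
dissipation of `ψ_a = exp(a‖v‖²)` over `(0,t]` is at most `(N+1)·C₀` — "what collisions destroy of
`ψ_a` was there at time 0" (telescoping + `ψ_a ≥ 0`). -/
def GaussianDissipationBudget : Prop :=
  ∀ (σ a C₀ : ℝ) (N : ℕ)
    (Φ : HardSphereFlow (Torus.geometry (Fin 3)) (hsDiameter σ N) (N + 1)),
    ∀ z ∈ Φ.good, 0 ∉ collisionTimes (Torus.geometry (Fin 3)) (hsDiameter σ N) (fun s => Φ.flow s z) →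
      ∀ t : ℝ, 0 ≤ t →
      (∑ i, Real.exp (a * ‖(Φ.flow 0 z i).2‖ ^ 2)) ≤ C₀ * (N + 1) →
        Φ.collisionSum (Ioc 0 t)
          (fun c : HardSphereCollisionRecord (Fin 3) T3 (N + 1) =>
            Real.exp (a * ‖c.preVel.1‖ ^ 2) - Real.exp (a * ‖c.postVel.1‖ ^ 2)) z ≤ C₀ * (N + 1)

/-- Card 2 (`lambda-dial-superextensive-cap`), first lemma — **the deterministic λ-dial gluing
inequality** (layer cake): along ANY configuration path on `[0,t]`, a speed cap
`‖vᵢ(s)‖² ≤ Rmax` plus Gaussian bounds `C' e^{-R/(2θ')}` on the time-averaged tail FRACTIONS for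
the levels `R₀ ≤ R ≤ R⋆` bound the time-averaged empirical Gaussian moment at any rate
`a < 1/(2θ')` by an explicit constant plus the top-regime term `C' e^{-R⋆/(2θ')} e^{a Rmax}`
(levels above `R⋆` are charged at the cap and counted with the `R⋆`-fraction). With
`R⋆ = r⋆ log N`, `Rmax = K log N` the last term is `t C' e^{1/(2θ')} N^{aK - r⋆/(2θ')} → 0` once
`a < r⋆/(2θ' K)`: the sub-extensive regime costs nothing. -/
def LambdaDialGluing : Prop :=
  ∀ (N : ℕ) (vel : ℝ → Fin (N + 1) → V3) (t θ' C' R₀ Rs Rmax a : ℝ), 0 < t → 0 < θ' → 0 ≤ C' →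
    0 ≤ R₀ → R₀ ≤ Rs → Rs ≤ Rmax → 0 < a → a < 1 / (2 * θ') →
    (∀ s ∈ Icc 0 t, ∀ i, ‖vel s i‖ ^ 2 ≤ Rmax) →
    (∀ R : ℝ, R₀ ≤ R → R ≤ Rs →
      (∫ s in Icc 0 t, (((Finset.univ.filter fun i : Fin (N + 1) => R < ‖vel s i‖ ^ 2).card : ℝ)
        / (N + 1))) ≤ t * C' * Real.exp (-R / (2 * θ'))) →
    (∀ i, Measurable fun s => vel s i) →
      (∫ s in Icc 0 t, (∑ i, Real.exp (a * ‖vel s i‖ ^ 2)) / (N + 1)) ≤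
        t * (Real.exp (a * (R₀ + 1)) + C' * Real.exp a / (1 - Real.exp (a - 1 / (2 * θ')))
          + t * C' * Real.exp (-(Rs - 1) / (2 * θ')) * Real.exp (a * Rmax))

end Summit.AtomisticToContinuum.HydrodynamicLimit.Cruxes.AprioriBounds.IdeatorTwo
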